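import Literature.NumberTheory.IwasawaTheory.ZpExtensionLayerRamificationDichotomy
import Literature.NumberTheory.IwasawaTheory.ZpExtensionNormKernelLayerPair
import Literature.NumberTheory.IwasawaTheory.ClassicalMuInvariantOnePrimeProofs
import Literature.NumberTheory.NumberFields.ClassGroupNormKernelOneRamifiedPrime
import HarnessLib

/-!
# The primes of a layer `K_m` ramified in `K_{m+1}` inject into the primes of `K` above `p` when the Fukuda index is `0`:
# `#{𝔓 ⊂ 𝓞 K_m ramified in K_{m+1}} ≤ #{w ⊂ 𝓞 K : p ∈ w}`

Topic `NumberTheory/IwasawaTheory` (namespace = path).  THEOREM-ONLY file (no definition, no named fact, no instance, no `sorry`), written by the prover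
seat `bsd-2adic-k4-w2` GEN 14 (cell `bsd-2adic`; `--supports` stmt-BirchSwinnertonDyer-22617; closes nothing).  It supplies the count `t` of the genus road
`classicalMuVanishes_of_rank_add_le_layer_succ_succ` (`ClassGroupCoinvariantGenusCriterion.lean`) from the base field alone.

* ★ `ncard_ramified_layer_succ_le_ncard_primes_above` — `κ` a `ℤ_p`-extension of the number field `K` with `TotallyRamifiedFrom κ 0`, layers
  `K_m ⊆ K_{m+1}` (inclusion algebra structure): **the number of primes of `K_m` ramified in `K_{m+1}` is at most the number of primes of `K` containing `p`.**
  Proof: a prime `𝔓` of `K_m` ramified in `K_{m+1}` lies under a prime `Q` of `K_{m+1}` with `e(Q | K_m) ≠ 1`, hence `e(Q | K) ≠ 1` (multiplicativity,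
  Mathlib `Ideal.ramificationIdx_tower`); `ℤ_p`-extensions are unramified outside `p` (`isUnramifiedAt_layer_of_natCast_not_mem_under`), so `p ∈ Q ∩ K`;
  and by the inertia dichotomy at index `0` (`ZpExtension.inertia_layer_eq_bot_or_forall_mem`: the inertia group of `Q` in `Gal(K_{m+1}/K)` is trivial or
  everything) `e(Q | K) = [K_{m+1} : K]`, so `Q` is the ONLY prime of `K_{m+1}` above `Q ∩ K` (`eq_of_under_eq_of_ramificationIdx_eq_finrank`): the map
  `𝔓 ↦ 𝔓 ∩ K` is injective on the ramified primes.

References: [Washington1997] §13.1 Prop. 13.2, Lemma 13.3 and §13.3 Lemma 13.15 (standing assumption); [Fukuda1994] p. 264 (the index `n₀`); [NeukirchANT1999]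
Ch. I §9 (9.1) (fundamental identity), Ch. II §8 (multiplicativity of `e`).
-/

set_option autoImplicit false

noncomputable section

open scoped NumberField
open NumberField IsDedekindDomain Field Ideal

namespace Literature.NumberTheory.IwasawaTheory

open Literature.NumberTheory.EllipticCurves Literature.NumberTheory.NumberFields
  Literature.NumberTheory.NumberFields.ClassGroupNormKernel
  Literature.NumberTheory.GaloisRepresentations

variable {K : Type} [Field K] [NumberField K] {p : ℕ} [hp : Fact p.Prime]

/-- ★ **The ramified primes of `K_{m+1}/K_m` inject into the primes of `K` above `p` (Fukuda index `0`).**  `κ` a `ℤ_p`-extension of the number field `K`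
with `TotallyRamifiedFrom κ 0`; `K_m ⊆ K_{m+1}` consecutive layers with the inclusion algebra structure.  Then
`#{𝔓 : e(𝔓, K_{m+1}/K_m) ≠ 1} ≤ #{w ⊂ 𝓞 K : p ∈ w}`.  (Every ramified prime of the pair lies over `p` — Washington Prop. 13.2 — and is totally ramified over
`K` — dichotomy at index `0` — so it is determined by its contraction to `K`.) [cite: Washington1997, §13.1 Prop. 13.2 and Lemma 13.3]
[cite: Fukuda1994, p. 264 (the index `n₀`)] [cite: NeukirchANT1999, Ch. I §9 Prop. (9.1)] -/
theorem ncard_ramified_layer_succ_le_ncard_primes_above (κ : ZpExtension K p) (hκ : TotallyRamifiedFrom κ 0) (m : ℕ)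
    [NumberField (κ.layer m)] [NumberField (κ.layer (m + 1))] :
    letI : Algebra (κ.layer m) (κ.layer (m + 1)) := (IntermediateField.inclusion (κ.layer_mono (Nat.le_succ m))).toRingHom.toAlgebra
    {v : HeightOneSpectrum (𝓞 (κ.layer m)) | v.asIdeal.ramificationIdxIn (𝓞 (κ.layer (m + 1))) ≠ 1}.ncard ≤
      {w : HeightOneSpectrum (𝓞 K) | ((p : ℕ) : 𝓞 K) ∈ w.asIdeal}.ncard := by
  classical
  set M := κ.layer m
  set L := κ.layer (m + 1)
  have hML : κ.layer m ≤ κ.layer (m + 1) := κ.layer_mono (Nat.le_succ m)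
  letI : Algebra M L := (IntermediateField.inclusion hML).toRingHom.toAlgebra
  haveI : IsScalarTower K M L := IsScalarTower.of_algebraMap_eq fun x => ((IntermediateField.inclusion hML).commutes x).symm
  haveI : FiniteDimensional K M := κ.finiteDimensional_layer_holds _
  haveI : FiniteDimensional K L := κ.finiteDimensional_layer_holds _
  haveI : IsGalois K L := κ.isGalois_layer_holds _
  haveI : FiniteDimensional M L := Module.Finite.of_restrictScalars_finite K M L
  haveI : IsGalois M L := isGalois_layer_layer κ
  have hpr : p.Prime := hp.out
  -- the target set is finite (prime factors of `(p)`)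
  have hp0 : (Ideal.span {((p : ℕ) : 𝓞 K)} : Ideal (𝓞 K)) ≠ ⊥ := by
    rw [Ne, Ideal.span_singleton_eq_bot]; exact_mod_cast hpr.ne_zero
  have hTfin : {w : HeightOneSpectrum (𝓞 K) | ((p : ℕ) : 𝓞 K) ∈ w.asIdeal}.Finite := by
    refine (Ideal.finite_factors hp0).subset fun w hw => ?_
    exact (Ideal.dvd_span_singleton).mpr hw
  -- the contraction map
  have hunder0 : ∀ v : HeightOneSpectrum (𝓞 M), v.asIdeal.under (𝓞 K) ≠ ⊥ := fun v =>
    mt Ideal.eq_bot_of_comap_eq_bot v.ne_bot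
  let f : HeightOneSpectrum (𝓞 M) → HeightOneSpectrum (𝓞 K) := fun v =>
    ⟨v.asIdeal.under (𝓞 K), Ideal.IsPrime.under (𝓞 K) v.asIdeal, hunder0 v⟩
  -- KEY: a ramified `v` has a prime `Q` of `L` above it which is TOTALLY ramified over `K` and lies over `p`
  have key : ∀ v : HeightOneSpectrum (𝓞 M), v.asIdeal.ramificationIdxIn (𝓞 L) ≠ 1 →
      ∃ (Q : Ideal (𝓞 L)) (_ : Q.IsMaximal), Q.LiesOver v.asIdeal ∧ Q.ramificationIdx (𝓞 K) = Module.finrank K L ∧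
        ((p : ℕ) : 𝓞 K) ∈ Q.under (𝓞 K) := by
    intro v hv
    haveI : v.asIdeal.IsMaximal := v.isMaximal
    obtain ⟨Q, hQmax, hQv⟩ := Ideal.exists_maximal_ideal_liesOver_of_isIntegral (S := 𝓞 L) v.asIdeal
    haveI := hQmax; haveI := hQv
    have heM : Q.ramificationIdx (𝓞 M) ≠ 1 := by
      rwa [Ideal.ramificationIdxIn_eq_ramificationIdx v.asIdeal Q (L ≃ₐ[M] L)] at hv
    -- `e(Q | K) ≠ 1` by multiplicativity
    have htower : Q.ramificationIdx (𝓞 K) = v.asIdeal.ramificationIdx (𝓞 K) * Q.ramificationIdx (𝓞 M) :=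
      Ideal.ramificationIdx_tower v.asIdeal Q
    have heK : Q.ramificationIdx (𝓞 K) ≠ 1 := by
      intro h1
      have hdvd : Q.ramificationIdx (𝓞 M) ∣ 1 := ⟨v.asIdeal.ramificationIdx (𝓞 K), by rw [← h1, htower, mul_comm]⟩
      exact heM (Nat.dvd_one.mp hdvd)
    -- hence `p ∈ Q ∩ K` (unramified outside `p`)
    have hpQ : ((p : ℕ) : 𝓞 K) ∈ Q.under (𝓞 K) := by
      by_contra hnot
      haveI := κ.isUnramifiedAt_layer_of_natCast_not_mem_under (m + 1) Q hnot
      exact heK (Ideal.ramificationIdx_eq_one_of_isUnramifiedAt (R := 𝓞 K) (p := Q))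
    -- and `Q` is totally ramified over `K`: inertia group = everything (dichotomy at index `0`)
    haveI : (Q.under (𝓞 K)).IsMaximal := Ideal.IsMaximal.under (𝓞 K) Q
    have hcard := Ideal.card_inertia_eq_ramificationIdxIn (G := L ≃ₐ[K] L) (Q.under (𝓞 K)) Q
    rw [Ideal.ramificationIdxIn_eq_ramificationIdx (Q.under (𝓞 K)) Q (L ≃ₐ[K] L)] at hcard
    have hne : Q.inertia (L ≃ₐ[K] L) ≠ ⊥ := by
      intro hbot
      rw [hbot, Subgroup.card_bot] at hcard
      exact heK hcard.symm
    rcases κ.inertia_layer_eq_bot_or_forall_mem hκ (n := 0) (m := m + 1) le_rfl (Nat.zero_le _) Q with h1 | h2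
    · exact absurd h1 hne
    · have htop : Q.inertia (L ≃ₐ[K] L) = ⊤ := by
        refine top_le_iff.mp fun g _ => h2 g fun x hx => ?_
        rw [κ.layer_zero, IntermediateField.mem_bot] at hx
        obtain ⟨k, hk⟩ := hx
        have hx' : x = algebraMap K L k := Subtype.ext hk.symm
        rw [hx', AlgEquiv.commutes]
      rw [htop, Subgroup.card_top, Nat.card_eq_fintype_card, ← Nat.card_eq_fintype_card, IsGalois.card_aut_eq_finrank] at hcard
      exact ⟨Q, hQmax, hQv, hcard.symm, hpQ⟩
  -- maps into the target
  have hmaps : Set.MapsTo f {v | v.asIdeal.ramificationIdxIn (𝓞 L) ≠ 1} {w | ((p : ℕ) : 𝓞 K) ∈ w.asIdeal} := by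
    intro v hv
    obtain ⟨Q, hQmax, hQv, -, hpQ⟩ := key v hv
    show ((p : ℕ) : 𝓞 K) ∈ v.asIdeal.under (𝓞 K)
    have : Q.under (𝓞 K) = v.asIdeal.under (𝓞 K) := by
      rw [hQv.over, Ideal.under_under]
    rwa [this] at hpQ
  -- injective on the ramified primes
  have hinj : Set.InjOn f {v | v.asIdeal.ramificationIdxIn (𝓞 L) ≠ 1} := by
    intro v hv v' hv' hfv
    obtain ⟨Q, hQmax, hQv, hQe, -⟩ := key v hv
    obtain ⟨Q', hQ'max, hQ'v, -, -⟩ := key v' hv'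
    haveI := hQmax; haveI := hQ'max
    have hw : v.asIdeal.under (𝓞 K) = v'.asIdeal.under (𝓞 K) := by
      have := congrArg HeightOneSpectrum.asIdeal hfv
      exact this
    have h1 : Q.under (𝓞 K) = v.asIdeal.under (𝓞 K) := by rw [hQv.over, Ideal.under_under]
    have h2 : Q'.under (𝓞 K) = v'.asIdeal.under (𝓞 K) := by rw [hQ'v.over, Ideal.under_under]
    have hQQ' : Q'.under (𝓞 K) = Q.under (𝓞 K) := by rw [h2, ← hw, ← h1]
    have heq : Q' = Q := eq_of_under_eq_of_ramificationIdx_eq_finrank (B := K) (F := L) Q hQe Q' hQQ'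
    apply HeightOneSpectrum.ext
    rw [hQv.over, hQ'v.over, heq]
  exact Set.ncard_le_ncard_of_injOn f hmaps hinj hTfin

end Literature.NumberTheory.IwasawaTheory

end
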